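import Mathlib.Data.Real.Basic
import Mathlib.Tactic.Linarith
import Mathlib.Tactic.Positivity
import HarnessLib

/-!
# The PATH box bound — the elementary inequality behind the non-adjacent ('N-class') accounting of kernel rows — prim-lf-2 gen 59

Support file (`--supports stmt-CriticalPhenomena-4575`, closed), prover `prim-lf-2` (gen 59).  No definitions, no named facts, no sorries; standard axioms.
Memo `prim-lf-2/CW-KERNEL-gen59.md` §6.6; companions `…RootSetKernelRowTwoPrep.lean` (`skew_box_bound`, `split_box_bound`).

With `T(X,Y) := (f X − f Y)(g X − g Y)` for monotone `f, g` and vertex sets `c ⊆ Q ⊆ A`, `c ⊆ Y ⊆ A`, `Q ⊆ Q'`, `Y ⊆ Y'` (no relation between `Q'`, `Y'`, `A` otherwise):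
  `T(c,A) + T(Q,Y') + T(Y,Q') ≥ T(Q',Y')`.
This is the certificate of the row-2 kernel atom with `q ≁ y` (together with `split_box_bound`), where the incomparable 'N-class' term `T(Q,Y')` (red cluster through `q` against blue
cluster through `y`) is paid jointly by the surplus `T(c,A)` of the large deficit and the opposite mixed term; with `Q' = Q`, `Y' = Y` it is `NC(path q–c–y)/2 ≥ 0`.
* `Coefficientwise.path_box_bound` — the inequality for reals: `0 ≤ f_Q, f_Y ≤ f_A`, `f_Q ≤ f_Q'`, `f_Y ≤ f_Y'` (values relative to `f_c = 0`, `g_c = 0`), stated with explicit `f_c, g_c`.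
[cite: KozmaNitzan2024, Questions 8–9 (§5.5 p. 36) (context: the Question-8 pocket covariance programme)]
-/

namespace Summit.CriticalPhenomena.PercolationContinuityZ3.Theorems

namespace Coefficientwise

/-- **PATH box bound**: `f_c ≤ f_Q ≤ f_A`, `f_c ≤ f_Y ≤ f_A`, `f_Q ≤ f_Q'`, `f_Y ≤ f_Y'` (and likewise for `g`) imply
`(f_Q' − f_Y')(g_Q' − g_Y') ≤ (f_A − f_c)(g_A − g_c) + (f_Q − f_Y')(g_Q − g_Y') + (f_Y − f_Q')(g_Y − g_Q')`. [folklore] -/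
theorem path_box_bound {fc fQ fY fA fQ' fY' gc gQ gY gA gQ' gY' : ℝ}
    (hcQ : fc ≤ fQ) (hQA : fQ ≤ fA) (hcY : fc ≤ fY) (hYA : fY ≤ fA) (hQQ' : fQ ≤ fQ') (hYY' : fY ≤ fY')
    (hcQ' : gc ≤ gQ) (hQA' : gQ ≤ gA) (hcY' : gc ≤ gY) (hYA' : gY ≤ gA) (hQQ'' : gQ ≤ gQ') (hYY'' : gY ≤ gY') :
    (fQ' - fY') * (gQ' - gY') ≤ (fA - fc) * (gA - gc) + (fQ - fY') * (gQ - gY') + (fY - fQ') * (gY - gQ') := by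
  -- after the shift `f_c = g_c = 0`: RHS − LHS = [sσ + (a−b)(α−β)] + (β' − β)(a' − a) + (α' − α)(b' − b) + β(a'−a) − β(a'−a) …; we give `nlinarith` the four products
  have h1 : 0 ≤ (fQ' - fQ) * (gY' - gY) := mul_nonneg (sub_nonneg.mpr hQQ') (sub_nonneg.mpr hYY'')
  have h2 : 0 ≤ (fY' - fY) * (gQ' - gQ) := mul_nonneg (sub_nonneg.mpr hYY') (sub_nonneg.mpr hQQ'')
  have h3 : 0 ≤ (fQ' - fQ) * (gY - gc) := mul_nonneg (sub_nonneg.mpr hQQ') (by linarith)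
  have h4 : 0 ≤ (fY' - fY) * (gQ - gc) := mul_nonneg (sub_nonneg.mpr hYY') (by linarith)
  have h5 : 0 ≤ (fQ - fc) * (gY' - gY) := mul_nonneg (sub_nonneg.mpr hcQ) (sub_nonneg.mpr hYY'')
  have h6 : 0 ≤ (fY - fc) * (gQ' - gQ) := mul_nonneg (sub_nonneg.mpr hcY) (sub_nonneg.mpr hQQ'')
  -- the core `sσ + (a − b)(α − β) ≥ 0` with `s ≥ max(a,b) ≥ 0`, `σ ≥ max(α,β) ≥ 0`, by cases on the signs of `a − b`, `α − β`
  have core : 0 ≤ (fA - fc) * (gA - gc) + (fQ - fY) * (gQ - gY) := by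
    rcases le_or_gt fQ fY with hab | hab <;> rcases le_or_gt gQ gY with hab' | hab'
    · nlinarith [mul_nonneg (sub_nonneg.mpr hab) (sub_nonneg.mpr hab')]
    · nlinarith [mul_nonneg (sub_nonneg.mpr hab) (sub_nonneg.mpr hab'.le), mul_nonneg (sub_nonneg.mpr hYA) (sub_nonneg.mpr hQA'),
        mul_nonneg (sub_nonneg.mpr hcQ) (sub_nonneg.mpr hcY'), mul_nonneg (sub_nonneg.mpr (hcQ.trans hQA)) (sub_nonneg.mpr hcY')]
    · nlinarith [mul_nonneg (sub_nonneg.mpr hab.le) (sub_nonneg.mpr hab'), mul_nonneg (sub_nonneg.mpr hQA) (sub_nonneg.mpr hYA'),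
        mul_nonneg (sub_nonneg.mpr hcY) (sub_nonneg.mpr hcQ'), mul_nonneg (sub_nonneg.mpr (hcY.trans hYA)) (sub_nonneg.mpr hcQ')]
    · nlinarith [mul_nonneg (sub_nonneg.mpr hab.le) (sub_nonneg.mpr hab'.le)]
  nlinarith [h1, h2, h3, h4, h5, h6, core]

end Coefficientwise

end Summit.CriticalPhenomena.PercolationContinuityZ3.Theorems
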